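import Summits.CriticalPhenomena.PercolationContinuityZ3.Theorems.PercNearOneGluingNoHeavyQuantKnOrbitSharp
import HarnessLib

/-!
# QUANT lane, gen 4 (prim-quant-p3): the closed form of the uniqueness tolerance `knTauU d` for every `d ≥ 1` and kernel sandwiches
# of the ORBIT defect `knTauU d ^ (d·2^d)` for `d = 3, 4, 5, 6` (CALIBRATION.md §5 rows, previously "implementation A only")

builds on p205010 (kernel theorem, internal audit signed; external expert review pending)

Cell `prim-quant` (LANE 1, `run/shared/lean/prim/quant/`; CONSTANTS.md §1/§5, CALIBRATION.md §5).  The explicit rate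
`π_{p_c(ℤ^d)}(N) ≤ (1 − knTauU d ^ (d·2^d))^⌊(log*₂ N − knShiftC d)/2⌋` (`oneArm_explicit_rate_logStar_half_orbit`, gen 3) holds for every `d ≥ 3`;
its base was a kernel numeral only for `d = 3` (`…QuantKnOrbitSharp`: `2^{-6284} < knTauU 3 ^ 24 < 2^{-6283}`).  Here:

* `knDeltaCorr_le_knDelta`, `knTau1_eq_knDeltaCorr_sq`, `knDeltaE_eq_closedForm`, `knTauU_eq_closedForm`, `knTauU_pow_closedForm` — for every `d ≥ 1`
  the finest tolerance is the corridor one, so `knDeltaE d = 1/(2⁶⁴·(96(d+1))²·200·knK)` and `knTauU d ^ E = 1/(2^E·(2⁶⁴·(96(d+1))²·200·knK)^{2E})`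
  (`d = 3`: `(96·4)²·200 = 29491200`, census-1's `knDeltaE_three_eq`);
* `one_div_sandwich_of_nat` — the generic numeral step: from `Klo ≤ knK ≤ Khi` and two `decide`d integer inequalities, `(1/2)^{a+1} < 1/(A·(C·knK)^n) < (1/2)^a`;
* the sandwiches, each from census-1's certified `3334289807000 ≤ knK ≤ 3334289810000` and two kernel-decided integer comparisons:
  (`d = 3`: only the cast-form identity `knTauU_pow_orbit_three_eq` is recorded — the sandwich `(1/2)^6284 < knTauU 3 ^ 24 < (1/2)^6283` is `…OrbitSharp`'s
  `knTauU_pow_orbit_three_sharp`, and the same two `decide`s reproduce it from this identity; not restated);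
  `knTauU_pow_orbit_four_sharp`  : `(1/2)^16840  < knTauU 4 ^ 64  < (1/2)^16839`   (interval value `log₂ = −16839.444`);
  `knTauU_pow_orbit_five_sharp`  : `(1/2)^42267  < knTauU 5 ^ 160 < (1/2)^42266`   (`−42266.951`);
  `knTauU_pow_orbit_six_sharp`   : `(1/2)^101783 < knTauU 6 ^ 384 < (1/2)^101782`  (`−101782.278`);
* the displayed rates `oneArm_explicit_rate_logStar_half_orbit_numeral_four/five/six` :
  `π_{p_c(ℤ⁴)}(N) ≤ (1 − 2^{-16840})^⌊(log*₂ N − knShiftC 4)/2⌋`, `π_{p_c(ℤ⁵)}(N) ≤ (1 − 2^{-42267})^⌊…⌋`, `π_{p_c(ℤ⁶)}(N) ≤ (1 − 2^{-101783})^⌊…⌋`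
  (`knShiftC d` stays symbolic for `d ≥ 4`; only `knShiftC 3 ≤ 6` is a kernel numeral, prim-quant-p4).

HONEST SIZE (unchanged): explicit functions tending to `0` and nothing more (iterated-logarithm type) in every `d ≥ 3`; (T1) polynomial is OPEN; for `d ≥ 11`
(nearest-neighbour, in print `d ≥ 11` Fitzner–van der Hofstad) mean-field rates are known and these displays are not competitive — they are calibration lines.
No definitions, no sorries; standard axioms.  [cite: KozmaNitzan2024, §4 Theorem 6 (pp. 25–31)] [cite: GrimmettPercolation1999, §7.2 (7.14)–(7.16) p. 151]
-/

noncomputable section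

namespace Summit.CriticalPhenomena.PercolationContinuityZ3.Theorems.Quant

open MeasureTheory Literature.Probability.Percolation Literature.Probability.LatticeModels
open Literature.Probability.Percolation.GM (HOct)

variable {d : ℕ}

/-! ## Closed form of `knTauU d`, every `d ≥ 1` -/

/-- For `d ≥ 1` the corridor tolerance is the finer one: `knDeltaCorr d = ε/(96(d+1)) ≤ ε/192 = knDelta`. [folklore] -/
theorem knDeltaCorr_le_knDelta (hd : 1 ≤ d) : knDeltaCorr d ≤ knDelta := by
  unfold knDeltaCorr knDelta
  have hε := knEps_pos
  have hd' : (1 : ℝ) ≤ d := by exact_mod_cast hd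
  exact div_le_div_of_nonneg_left hε.le (by norm_num) (by nlinarith)

/-- For `d ≥ 1`: `knTau1 d = knDeltaCorr d ²`. [folklore] -/
theorem knTau1_eq_knDeltaCorr_sq (hd : 1 ≤ d) : knTau1 d = knDeltaCorr d ^ 2 := by
  unfold knTau1
  exact min_eq_right (pow_le_pow_left₀ (knDeltaCorr_pos d).le (knDeltaCorr_le_knDelta hd) 2)

/-- **Closed form of `knDeltaE d`, `d ≥ 1`**: `knDeltaE d = 1/(2⁶⁴ · ((96(d+1))²·200) · knK)` (`ε = 2⁻³²`). [folklore] -/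
theorem knDeltaE_eq_closedForm (hd : 1 ≤ d) :
    knDeltaE d = 1 / (2 ^ 64 * ((96 * ((d : ℝ) + 1)) ^ 2 * 200) * (knK : ℝ)) := by
  unfold knDeltaE
  rw [knTau1_eq_knDeltaCorr_sq hd]
  unfold knDeltaCorr
  have hε : knEps = (1 / 2) ^ 32 := rfl
  have hK0 : (0 : ℝ) < knK := by exact_mod_cast knK_pos
  have hd0 : (0 : ℝ) < 96 * ((d : ℝ) + 1) := by positivity
  rw [hε]
  field_simp

/-- **Closed form of the uniqueness tolerance, `d ≥ 1`**: `knTauU d = 1/(2 · (2⁶⁴ · ((96(d+1))²·200) · knK)²)`. [folklore] -/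
theorem knTauU_eq_closedForm (hd : 1 ≤ d) :
    knTauU d = 1 / (2 * (2 ^ 64 * ((96 * ((d : ℝ) + 1)) ^ 2 * 200) * (knK : ℝ)) ^ 2) := by
  unfold knTauU
  rw [knDeltaE_eq_closedForm hd]
  have hK0 : (0 : ℝ) < knK := by exact_mod_cast knK_pos
  have hD : (0 : ℝ) < 2 ^ 64 * ((96 * ((d : ℝ) + 1)) ^ 2 * 200) * (knK : ℝ) := by positivity
  field_simp

/-- Powers of the closed form: `knTauU d ^ E = 1/(2^E · (2⁶⁴ · ((96(d+1))²·200) · knK)^{2E})`, `d ≥ 1`. [folklore] -/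
theorem knTauU_pow_closedForm (hd : 1 ≤ d) (E : ℕ) :
    knTauU d ^ E = 1 / (2 ^ E * (2 ^ 64 * ((96 * ((d : ℝ) + 1)) ^ 2 * 200) * (knK : ℝ)) ^ (2 * E)) := by
  rw [knTauU_eq_closedForm hd, one_div_pow, mul_pow, ← pow_mul]

/-! ## The generic numeral step -/

/-- **Numeral sandwich for a reciprocal**: if `Klo ≤ K ≤ Khi` (`0 < Klo`), `2^a < A·(C·Klo)^n` and `A·(C·Khi)^n < 2^{a+1}` (integer facts), then
`(1/2)^{a+1} < 1/(A·(C·K)^n) < (1/2)^a` over `ℝ`. [folklore] (numeric) -/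
theorem one_div_sandwich_of_nat {A C Klo Khi K n a : ℕ} (hA : 0 < A) (hC : 0 < C) (hK0 : 0 < Klo) (hKlo : Klo ≤ K) (hKhi : K ≤ Khi)
    (hlo : 2 ^ a < A * (C * Klo) ^ n) (hhi : A * (C * Khi) ^ n < 2 ^ (a + 1)) :
    (1 / 2 : ℝ) ^ (a + 1) < 1 / ((A : ℝ) * ((C : ℝ) * (K : ℝ)) ^ n) ∧
      1 / ((A : ℝ) * ((C : ℝ) * (K : ℝ)) ^ n) < (1 / 2 : ℝ) ^ a := by
  have hcast : (A : ℝ) * ((C : ℝ) * (K : ℝ)) ^ n = ((A * (C * K) ^ n : ℕ) : ℝ) := by push_cast; ring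
  have h2a : (1 / 2 : ℝ) ^ a = 1 / ((2 ^ a : ℕ) : ℝ) := by rw [Nat.cast_pow, Nat.cast_ofNat, one_div_pow]
  have h2a1 : (1 / 2 : ℝ) ^ (a + 1) = 1 / ((2 ^ (a + 1) : ℕ) : ℝ) := by rw [Nat.cast_pow, Nat.cast_ofNat, one_div_pow]
  rw [hcast, h2a, h2a1]
  have hKpos : 0 < K := hK0.trans_le hKlo
  have hmonoHi : A * (C * K) ^ n ≤ A * (C * Khi) ^ n :=
    Nat.mul_le_mul_left _ (Nat.pow_le_pow_left (Nat.mul_le_mul_left _ hKhi) _)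
  have hmonoLo : A * (C * Klo) ^ n ≤ A * (C * K) ^ n :=
    Nat.mul_le_mul_left _ (Nat.pow_le_pow_left (Nat.mul_le_mul_left _ hKlo) _)
  have hposX : (0 : ℝ) < ((A * (C * K) ^ n : ℕ) : ℝ) := by
    exact_mod_cast Nat.mul_pos hA (pow_pos (Nat.mul_pos hC hKpos) _)
  have hpos2a : (0 : ℝ) < ((2 ^ a : ℕ) : ℝ) := by exact_mod_cast pow_pos two_pos _
  refine ⟨one_div_lt_one_div_of_lt hposX ?_, one_div_lt_one_div_of_lt hpos2a ?_⟩
  · exact_mod_cast hmonoHi.trans_lt hhi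
  · exact_mod_cast hlo.trans_le hmonoLo

/-! ## `d = 3` (closed form in cast form; the sandwich is `knTauU_pow_orbit_three_sharp` of `…OrbitSharp`) -/

/-- `knTauU 3 ^ (3·2^3) = 1/(2^24 · (2^64·29491200·knK)^48)` in the cast form of `one_div_sandwich_of_nat`. [folklore] -/
theorem knTauU_pow_orbit_three_eq :
    knTauU 3 ^ (3 * 2 ^ 3) = 1 / (((2 ^ 24 : ℕ) : ℝ) * (((2 ^ 64 * 29491200 : ℕ) : ℝ) * (knK : ℝ)) ^ 48) := by
  rw [show (3 : ℕ) * 2 ^ 3 = 24 by norm_num, knTauU_pow_closedForm (by norm_num) 24]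
  push_cast
  norm_num

/-! ## `d = 4` -/

/-- `knTauU 4 ^ (4·2^4) = 1/(2^64 · (2^64·46080000·knK)^128)` (`(96·5)²·200 = 46080000`). [folklore] -/
theorem knTauU_pow_orbit_four_eq :
    knTauU 4 ^ (4 * 2 ^ 4) = 1 / (((2 ^ 64 : ℕ) : ℝ) * (((2 ^ 64 * 46080000 : ℕ) : ℝ) * (knK : ℝ)) ^ 128) := by
  rw [show (4 : ℕ) * 2 ^ 4 = 64 by norm_num, knTauU_pow_closedForm (by norm_num) 64]
  push_cast
  norm_num

/-- **`(1/2)^16840 < knTauU 4 ^ (4·2^4) < (1/2)^16839`** — the orbit defect on `ℤ⁴` to the last binary digit (interval value `log₂ = −16839.444`).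
[folklore] (numeric) -/
theorem knTauU_pow_orbit_four_sharp :
    (1 / 2 : ℝ) ^ 16840 < knTauU 4 ^ (4 * 2 ^ 4) ∧ knTauU 4 ^ (4 * 2 ^ 4) < (1 / 2 : ℝ) ^ 16839 := by
  rw [knTauU_pow_orbit_four_eq]
  exact one_div_sandwich_of_nat (A := 2 ^ 64) (C := 2 ^ 64 * 46080000) (Klo := 3334289807000) (Khi := 3334289810000)
    (K := knK) (n := 128) (a := 16839) (by positivity) (by positivity) (by norm_num) knK_ge_numeral knK_le_numeral
    (by decide +kernel) (by decide +kernel)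

/-- **`d = 4`, displayed form**: `π_{p_c(ℤ⁴)}(N) ≤ (1 − 2^{-16840})^⌊(log*₂ N − knShiftC 4)/2⌋`.  An explicit function tending to `0` and nothing more
(iterated-logarithm type).  builds on p205010 (kernel theorem, internal audit signed; external expert review pending). [cite: KozmaNitzan2024, §4 Theorem 6] -/
theorem oneArm_explicit_rate_logStar_half_orbit_numeral_four (N : ℕ) :
    oneArmProb 4 (criticalProbI 4) N ≤ (1 - (1 / 2 : ℝ) ^ 16840) ^ ((logStar 2 N - knShiftC 4) / 2) :=
  (oneArm_explicit_rate_logStar_half_orbit (d := 4) (by norm_num) N).trans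
    (pow_le_pow_left₀ (sub_nonneg.2 (knTauU_pow_orbit_le_one 4)) (sub_le_sub_left knTauU_pow_orbit_four_sharp.1.le 1) _)

/-! ## `d = 5` -/

/-- `knTauU 5 ^ (5·2^5) = 1/(2^160 · (2^64·66355200·knK)^320)` (`(96·6)²·200 = 66355200`). [folklore] -/
theorem knTauU_pow_orbit_five_eq :
    knTauU 5 ^ (5 * 2 ^ 5) = 1 / (((2 ^ 160 : ℕ) : ℝ) * (((2 ^ 64 * 66355200 : ℕ) : ℝ) * (knK : ℝ)) ^ 320) := by
  rw [show (5 : ℕ) * 2 ^ 5 = 160 by norm_num, knTauU_pow_closedForm (by norm_num) 160]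
  push_cast
  norm_num

/-- **`(1/2)^42267 < knTauU 5 ^ (5·2^5) < (1/2)^42266`** — the orbit defect on `ℤ⁵` to the last binary digit (interval value `log₂ = −42266.951`).
[folklore] (numeric) -/
theorem knTauU_pow_orbit_five_sharp :
    (1 / 2 : ℝ) ^ 42267 < knTauU 5 ^ (5 * 2 ^ 5) ∧ knTauU 5 ^ (5 * 2 ^ 5) < (1 / 2 : ℝ) ^ 42266 := by
  rw [knTauU_pow_orbit_five_eq]
  exact one_div_sandwich_of_nat (A := 2 ^ 160) (C := 2 ^ 64 * 66355200) (Klo := 3334289807000) (Khi := 3334289810000)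
    (K := knK) (n := 320) (a := 42266) (by positivity) (by positivity) (by norm_num) knK_ge_numeral knK_le_numeral
    (by decide +kernel) (by decide +kernel)

/-- **`d = 5`, displayed form**: `π_{p_c(ℤ⁵)}(N) ≤ (1 − 2^{-42267})^⌊(log*₂ N − knShiftC 5)/2⌋`.  An explicit function tending to `0` and nothing more
(iterated-logarithm type).  builds on p205010 (kernel theorem, internal audit signed; external expert review pending). [cite: KozmaNitzan2024, §4 Theorem 6] -/
theorem oneArm_explicit_rate_logStar_half_orbit_numeral_five (N : ℕ) :
    oneArmProb 5 (criticalProbI 5) N ≤ (1 - (1 / 2 : ℝ) ^ 42267) ^ ((logStar 2 N - knShiftC 5) / 2) :=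
  (oneArm_explicit_rate_logStar_half_orbit (d := 5) (by norm_num) N).trans
    (pow_le_pow_left₀ (sub_nonneg.2 (knTauU_pow_orbit_le_one 5)) (sub_le_sub_left knTauU_pow_orbit_five_sharp.1.le 1) _)

/-! ## `d = 6` -/

/-- `knTauU 6 ^ (6·2^6) = 1/(2^384 · (2^64·90316800·knK)^768)` (`(96·7)²·200 = 90316800`). [folklore] -/
theorem knTauU_pow_orbit_six_eq :
    knTauU 6 ^ (6 * 2 ^ 6) = 1 / (((2 ^ 384 : ℕ) : ℝ) * (((2 ^ 64 * 90316800 : ℕ) : ℝ) * (knK : ℝ)) ^ 768) := by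
  -- the constant first (no power above `norm_num`'s evaluation threshold appears in this step), then the exponent bookkeeping by `rw`
  have hc : (2 : ℝ) ^ 64 * ((96 * (((6 : ℕ) : ℝ) + 1)) ^ 2 * 200) * (knK : ℝ) = ((2 ^ 64 * 90316800 : ℕ) : ℝ) * (knK : ℝ) := by
    push_cast; norm_num
  rw [show (6 : ℕ) * 2 ^ 6 = 384 by norm_num, knTauU_pow_closedForm (by norm_num) 384, hc, show 2 * 384 = 768 by norm_num,
    Nat.cast_pow, Nat.cast_ofNat]

/-- **`(1/2)^101783 < knTauU 6 ^ (6·2^6) < (1/2)^101782`** — the orbit defect on `ℤ⁶` to the last binary digit (interval value `log₂ = −101782.278`).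
[folklore] (numeric) -/
theorem knTauU_pow_orbit_six_sharp :
    (1 / 2 : ℝ) ^ 101783 < knTauU 6 ^ (6 * 2 ^ 6) ∧ knTauU 6 ^ (6 * 2 ^ 6) < (1 / 2 : ℝ) ^ 101782 := by
  rw [knTauU_pow_orbit_six_eq]
  exact one_div_sandwich_of_nat (A := 2 ^ 384) (C := 2 ^ 64 * 90316800) (Klo := 3334289807000) (Khi := 3334289810000)
    (K := knK) (n := 768) (a := 101782) (by positivity) (by positivity) (by norm_num) knK_ge_numeral knK_le_numeral
    (by decide +kernel) (by decide +kernel)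

/-- **`d = 6`, displayed form**: `π_{p_c(ℤ⁶)}(N) ≤ (1 − 2^{-101783})^⌊(log*₂ N − knShiftC 6)/2⌋`.  An explicit function tending to `0` and nothing more
(iterated-logarithm type).  builds on p205010 (kernel theorem, internal audit signed; external expert review pending). [cite: KozmaNitzan2024, §4 Theorem 6] -/
theorem oneArm_explicit_rate_logStar_half_orbit_numeral_six (N : ℕ) :
    oneArmProb 6 (criticalProbI 6) N ≤ (1 - (1 / 2 : ℝ) ^ 101783) ^ ((logStar 2 N - knShiftC 6) / 2) :=
  (oneArm_explicit_rate_logStar_half_orbit (d := 6) (by norm_num) N).trans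
    (pow_le_pow_left₀ (sub_nonneg.2 (knTauU_pow_orbit_le_one 6)) (sub_le_sub_left knTauU_pow_orbit_six_sharp.1.le 1) _)

end Summit.CriticalPhenomena.PercolationContinuityZ3.Theorems.Quant

end
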